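import Literature.Geometry.DiscreteGeometry.DelsarteLinearProgrammingBound

/-!
# Spherical codes: `A(7, 1/3) ≤ 56` — sharp Delsarte LP certificate

Framing: lottery ticket; floor = certified bounds/negative ranges. Venture `PackingBounds`
(cell `pub-packcert`), spherical-code family, LP-sharp row.

Every finite set of unit vectors of `ℝ^7` with pairwise inner products `≤ 1/3` has at most `56`
elements, and this is attained by the 56-point E₇ code in ℝ⁷ (28 equiangular lines) (inner products {±1/3, -1}; a universally optimal,
LP-sharp configuration, Cohn–Kumar 2007, Table 1; Levenshtein's bound). Proof: the linear
programming bound (`Literature.Geometry.DiscreteGeometry.DelsarteLP.card_le`) with the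
Levenshtein-type polynomial `f(t) = (t + 1) · (t + 1 / 3)² · (t - 1 / 3)` (degree 4), which is `≤ 0` on `[-1, 1/3]` by its
shape; its Gegenbauer coefficients for `S^6` (`μ = 5/2`, `C_k = gegenbauerSum 5/2 k`) are
`(8/189, 8/135, 152/3465, 8/315, 8/1155)`, all nonnegative, and `f(1) = 56 · f_0` EXACTLY (sharp). Exact rational certificate
generated and checked by two independent Gegenbauer implementations (cell code
`code/delsarte_exact.py`, `code/emit_codes.py`); the kernel re-verifies the identity and the value.

## References
* H. Cohn, A. Kumar, *Universally optimal distribution of points on spheres*, J. Amer. Math. Soc.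
  20 (2007) 99–148, Table 1. [`CohnKumar2006`]
* P. Delsarte, J. M. Goethals, J. J. Seidel, Geom. Dedicata 6 (1977) 363–388. [`DelsarteGoethalsSeidel1977`]
* V. I. Levenshtein, Soviet Math. Dokl. 20 (1979) 417–421. [`Levenshtein1979`]
-/

namespace Summit.Ventures.PackingBounds.SphericalCodes

open Finset Literature.Analysis.SpecialFunctions Literature.Geometry.DiscreteGeometry

/-- **`A(7, 1/3) ≤ 56`** (sharp; attained by the 56-point E₇ code in ℝ⁷ (28 equiangular lines)): a finite set of unit vectors of
`ℝ^7` with pairwise inner products `≤ 1/3` has at most `56` elements. Delsarte LP certificate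
`f(t) = (t + 1) · (t + 1 / 3)² · (t - 1 / 3)`, `f(1)/f_0 = 56` exactly. [cite: CohnKumar2006, Table 1] -/
theorem code_dim7_le_56 (C : Finset (EuclideanSpace ℝ (Fin 7)))
    (h1 : ∀ x ∈ C, ‖x‖ = 1) (h2 : ∀ x ∈ C, ∀ y ∈ C, x ≠ y → inner ℝ x y ≤ 1 / 3) :
    C.card ≤ 56 := by
  refine DelsarteLP.card_le (n := 7) (μ := (5 / 2)) (by norm_num) (by norm_num) 4
    (fun k => match k with
      | 0 => 8 / 189 | 1 => 8 / 135 | 2 => 152 / 3465 | 3 => 8 / 315 | 4 => 8 / 1155 | _ => 0)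
    ?_ (1 / 3) ?_ 56 (by norm_num) ?_ C h1 h2
  · intro k
    split <;> norm_num
  · intro t ht1 ht2
    have key : (t + 1) * (t + 1 / 3) ^ 2 * (t - 1 / 3) ≤ 0 :=
      mul_nonpos_of_nonneg_of_nonpos (mul_nonneg (by linarith) (by positivity)) (by linarith)
    have hsum : ∑ k ∈ range (4 + 1),
        (fun k => match k with
      | 0 => 8 / 189 | 1 => 8 / 135 | 2 => 152 / 3465 | 3 => 8 / 315 | 4 => 8 / 1155 | _ => 0) k * gegenbauerSum ((5 / 2) : ℝ) k t =
        (t + 1) * (t + 1 / 3) ^ 2 * (t - 1 / 3) := by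
      simp [Finset.sum_range_succ, gegenbauerSum, gegenbauerCoeff, Finset.prod_range_succ,
        Nat.factorial]
      ring
    rw [hsum]
    exact key
  · norm_num [Finset.sum_range_succ, gegenbauerSum, gegenbauerCoeff, Finset.prod_range_succ,
      Nat.factorial]

end Summit.Ventures.PackingBounds.SphericalCodes
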